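import Summits.RiemannHypothesis.RiemannHypothesis.Theorems.LiDirichletAsymptoticCharWindow
import Literature.NumberTheory.LFunctions.RiemannSiegelStirling
import HarnessLib

/-!
# RiemannHypothesis / LiDirichletAsymptotic — support S2χ `LiFarTailsChar`, part 1: the smooth part and the remainder
# integral of the Stieltjes integration of `1/t^k` (RH-FREE · GRH-FREE)

RH-FREE · GRH-FREE PROOF-OF-DATA (rung L-P(P1⁺χ)) [rh-li-prover].  Route `Theses/LiDirichletAsymptotic.lean`
(cell `pub/rh-li`), helper for item `LiFarTailsChar` (stmt-RiemannHypothesis-19632).  For the Stieltjes integration of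
`F = 1/t^k` against the two-sided count `N(t, χ)` (remainder identity `CharCount.finsum_window_sub_integral_eq`):

* the smooth part: `(2/π) g_χ(t) ≤ (1/π) log(qt/2π) + 1.39/t²` (`Re ψ(σ+iu) ≤ log u + K(σ)/u²`, tree
  `abs_re_digamma_vertical_sub_log_le`, `K(σ) ≤ 1.09`), hence
  `∫_T^U (2/π) g_χ/t^{j+2} ≤ (1/π)(log(qT/2π) + 1/(j+1))/((j+1)T^{j+1}) + 1.39/((j+3)T^{j+3})` (`integral_main_le`);
* the remainder part: `∫_T^U r(t)·k/t^{k+1} ≤ r(T)/T^k − r(U)/U^k + (12.975/k)(1/T^k − 1/U^k)`, `r = argSRem + 0.014`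
  (`integral_rem_le`; one integration by parts, `r'(t) = 12.975/(t+4) ≤ 12.975/t`).

Nothing here bears on the truth of RH or GRH.
-/

noncomputable section

-- D-0017: `Summit.<S>.<S>.…` is the designed namespace of a single-problem summit.
set_option linter.dupNamespace false

open MeasureTheory intervalIntegral Set Filter
open scoped Topology

namespace Summit.RiemannHypothesis.RiemannHypothesis.Theorems.LiTheory

open Literature.NumberTheory.LFunctions Literature.NumberTheory.LFunctions.ExplicitPsiChar
open Literature.NumberTheory.LFunctions.DirichletTheta
open Literature.NumberTheory.LFunctions.DirichletDisc (zeroOrder)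
open Complex (I)

namespace FarChar

variable {q : ℕ} [NeZero q] {χ : DirichletCharacter ℂ q}

variable {q : ℕ} [NeZero q] {χ : DirichletCharacter ℂ q}

/-! ### Calculus of `1/t^k` -/

/-- `d/dt (1/t^k) = −k/t^{k+1}` off `0` (`k ≠ 0`). -/
theorem hasDerivAt_one_div_pow {k : ℕ} (hk : k ≠ 0) {t : ℝ} (ht : t ≠ 0) :
    HasDerivAt (fun x : ℝ ↦ 1 / x ^ k) (-(k : ℝ) / t ^ (k + 1)) t := by
  obtain ⟨j, rfl⟩ := Nat.exists_eq_add_one_of_ne_zero hk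
  have h := (hasDerivAt_const t (1 : ℝ)).div (hasDerivAt_pow (j + 1) t) (pow_ne_zero _ ht)
  refine h.congr_deriv ?_
  rw [show j + 1 - 1 = j by omega]
  push_cast
  field_simp
  ring

/-- `∫_T^U k/t^{k+1} dt = 1/T^k − 1/U^k` for `0 < T ≤ U`, `k ≠ 0`. -/
theorem integral_div_pow_succ {k : ℕ} (hk : k ≠ 0) {T U : ℝ} (hT : 0 < T) (hTU : T ≤ U) :
    ∫ t in T..U, (k : ℝ) / t ^ (k + 1) = 1 / T ^ k - 1 / U ^ k := by
  have hne : ∀ t ∈ uIcc T U, t ≠ 0 := fun t ht ↦ by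
    rw [uIcc_of_le hTU] at ht; exact (lt_of_lt_of_le hT ht.1).ne'
  have hd : ∀ t ∈ uIcc T U, HasDerivAt (fun x : ℝ ↦ (-1 : ℝ) * (1 / x ^ k)) ((k : ℝ) / t ^ (k + 1)) t :=
    fun t ht ↦ ((hasDerivAt_one_div_pow hk (hne t ht)).const_mul (-1 : ℝ)).congr_deriv (by ring)
  have hi : IntervalIntegrable (fun t : ℝ ↦ (k : ℝ) / t ^ (k + 1)) volume T U := by
    refine ContinuousOn.intervalIntegrable (continuousOn_of_forall_continuousAt fun t ht ↦ ?_)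
    have : t ^ (k + 1) ≠ 0 := pow_ne_zero _ (hne t ht)
    fun_prop (disch := assumption)
  rw [integral_eq_sub_of_hasDerivAt hd hi]
  ring

/-! ### The remainder majorant `r = argSRem + 0.014` and its integral against `k/t^{k+1}` -/

omit [NeZero q] in
/-- `d/dt argSRem q t = 12.975/(t + 4)` for `t > −4` (`q ≥ 1`). -/
theorem hasDerivAt_argSRem (hq : 1 < q) {t : ℝ} (ht : 0 < t) :
    HasDerivAt (fun s : ℝ ↦ argSRem q s + 0.014) (12.975 / (t + 4)) t := by
  have hq0 : (0 : ℝ) < q := by exact_mod_cast lt_trans zero_lt_one hq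
  have hpos : (9.1902 : ℝ) * q * (t + 4) ≠ 0 := by positivity
  have h1 : HasDerivAt (fun s : ℝ ↦ (9.1902 : ℝ) * q * (s + 4)) (9.1902 * q) t := by
    have := ((hasDerivAt_id t).add_const 4).const_mul ((9.1902 : ℝ) * q)
    simpa using this
  have h2 := ((h1.log hpos).const_mul (12.975 : ℝ)).const_add 5
  have h3 := h2.add_const (0.014 : ℝ)
  have e : (fun s : ℝ ↦ argSRem q s + 0.014) =
      fun s ↦ 5 + 12.975 * Real.log (9.1902 * q * (s + 4)) + 0.014 := by
    funext s; rfl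
  rw [e]
  refine h3.congr_deriv ?_
  field_simp

omit [NeZero q] in
/-- `∫_T^U r(t)·k/t^{k+1} dt ≤ r(T)/T^k − r(U)/U^k + (12.975/k)(1/T^k − 1/U^k)`, `r = argSRem + 0.014` (by parts;
`r' = 12.975/(t+4) ≤ 12.975/t`). -/
theorem integral_rem_le (hq : 1 < q) {k : ℕ} (hk : k ≠ 0) {T U : ℝ} (hT : 1 ≤ T) (hTU : T ≤ U) :
    ∫ t in T..U, (argSRem q t + 0.014) * ((k : ℝ) / t ^ (k + 1)) ≤
      (argSRem q T + 0.014) * (1 / T ^ k) - (argSRem q U + 0.014) * (1 / U ^ k) +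
        12.975 / k * (1 / T ^ k - 1 / U ^ k) := by
  have hT0 : 0 < T := by linarith
  have hk0 : (0 : ℝ) < k := by exact_mod_cast Nat.pos_of_ne_zero hk
  have hne : ∀ t ∈ uIcc T U, 0 < t := fun t ht ↦ by
    rw [uIcc_of_le hTU] at ht; exact lt_of_lt_of_le hT0 ht.1
  -- by parts: `u = r`, `v = −1/t^k`
  have hu : ∀ t ∈ uIcc T U, HasDerivAt (fun s : ℝ ↦ argSRem q s + 0.014) (12.975 / (t + 4)) t :=
    fun t ht ↦ hasDerivAt_argSRem hq (hne t ht)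
  have hv : ∀ t ∈ uIcc T U, HasDerivAt (fun x : ℝ ↦ (-1 : ℝ) * (1 / x ^ k)) ((k : ℝ) / t ^ (k + 1)) t :=
    fun t ht ↦ ((hasDerivAt_one_div_pow hk (hne t ht).ne').const_mul (-1 : ℝ)).congr_deriv (by ring)
  have hu' : IntervalIntegrable (fun t : ℝ ↦ 12.975 / (t + 4)) volume T U := by
    refine ContinuousOn.intervalIntegrable (continuousOn_of_forall_continuousAt fun t ht ↦ ?_)
    have : t + 4 ≠ 0 := by linarith [hne t ht]
    fun_prop (disch := assumption)
  have hv' : IntervalIntegrable (fun t : ℝ ↦ (k : ℝ) / t ^ (k + 1)) volume T U := by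
    refine ContinuousOn.intervalIntegrable (continuousOn_of_forall_continuousAt fun t ht ↦ ?_)
    have : t ^ (k + 1) ≠ 0 := pow_ne_zero _ (hne t ht).ne'
    fun_prop (disch := assumption)
  have hparts := intervalIntegral.integral_mul_deriv_eq_deriv_mul hu hv hu' hv'
  rw [hparts]
  -- the last integral: `∫ (12.975/(t+4)) · (−1/t^k) ≥ −(12.975/k)(1/T^k − 1/U^k)`
  have hI : ∫ t in T..U, 12.975 / (t + 4) * ((-1 : ℝ) * (1 / t ^ k)) ≥
      -(12.975 / k * (1 / T ^ k - 1 / U ^ k)) := by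
    rw [← integral_div_pow_succ hk hT0 hTU, ← intervalIntegral.integral_const_mul, ← intervalIntegral.integral_neg]
    refine intervalIntegral.integral_mono_on hTU ?_ ?_ fun t ht ↦ ?_
    · refine ((ContinuousOn.intervalIntegrable (continuousOn_of_forall_continuousAt fun t ht ↦ ?_))).neg
      have : t ^ (k + 1) ≠ 0 := pow_ne_zero _ (hne t ht).ne'
      fun_prop (disch := assumption)
    · exact hu'.mul_continuousOn (continuousOn_of_forall_continuousAt fun t ht ↦ by
        have : t ^ k ≠ 0 := pow_ne_zero _ (hne t ht).ne'
        fun_prop (disch := assumption))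
    · have ht0 : 0 < t := lt_of_lt_of_le hT0 ht.1
      have hpk : 0 < t ^ k := pow_pos ht0 k
      -- `−12.975·(k/t^{k+1})/k ≤ −12.975/((t+4) t^k)`
      have e1 : -(12.975 / (k : ℝ) * ((k : ℝ) / t ^ (k + 1))) = -(12.975 / (t * t ^ k)) := by
        field_simp
        ring
      have e2 : 12.975 / (t + 4) * ((-1 : ℝ) * (1 / t ^ k)) = -(12.975 / ((t + 4) * t ^ k)) := by
        field_simp
      rw [e1, e2, neg_le_neg_iff]
      exact div_le_div_of_nonneg_left (by norm_num) (by positivity) (by nlinarith)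
  linarith [hI]

/-! ### The smooth part: `(2/π) g_χ(t) ≤ (1/π) log(qt/2π) + 1.39/t²` and its integral against `1/t^k` -/

/-- `(2/π) g_χ(t) ≤ (1/π) log(qt/(2π)) + 1.39/t²` for `t ≥ 2` (`Re ψ(σ+iu) ≤ log u + K(σ)/u²`, `K(σ) ≤ 1.09` for
`σ = ¼ + a/2 ≤ ¾`). -/
theorem two_div_pi_mul_charGammaDensity_le (χ : DirichletCharacter ℂ q) {t : ℝ} (ht : 2 ≤ t) :
    2 / Real.pi * charGammaDensity χ t ≤ 1 / Real.pi * Real.log (q * t / (2 * Real.pi)) + 1.39 / t ^ 2 := by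
  have hπ := Real.pi_gt_three
  have hπ4 := Real.pi_lt_d2
  have hπ0 := Real.pi_pos
  have ht0 : 0 < t := by linarith
  have hq : (0 : ℝ) < q := by exact_mod_cast Nat.pos_of_ne_zero (NeZero.ne q)
  have hκ : charParity χ = 0 ∨ charParity χ = 1 := by
    rcases χ.even_or_odd with h | h
    · exact Or.inl (charParity_of_even h)
    · exact Or.inr (charParity_of_odd h)
  set σ : ℝ := 1 / 4 + (charParity χ : ℝ) / 2 with hσ
  have hσ0 : 0 < σ := by rw [hσ]; positivity
  have hσ1 : σ ≤ 3 / 4 := by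
    rcases hκ with h | h <;> rw [hσ, h] <;> norm_num
  have hK : stirlingVertRate σ ≤ 1.09 := by
    unfold stirlingVertRate
    nlinarith
  have hdig := abs_re_digamma_vertical_sub_log_le hσ0 (show (1 : ℝ) ≤ t / 2 by linarith)
  have e : charGammaDensity χ t = (Complex.digamma ((σ : ℂ) + ((t / 2 : ℝ) : ℂ) * I)).re / 2 +
      Real.log (q / Real.pi) / 2 := by
    unfold charGammaDensity Complex.digamma
    congr 3
    rw [hσ]; push_cast; ring
  rw [e, Real.log_div hq.ne' hπ0.ne']
  have hlog : Real.log (q * t / (2 * Real.pi)) = Real.log q + Real.log (t / 2) - Real.log Real.pi := by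
    rw [Real.log_div (by positivity) (by positivity), Real.log_mul hq.ne' ht0.ne',
      Real.log_mul (by norm_num) hπ0.ne', Real.log_div ht0.ne' (by norm_num)]
    ring
  rw [hlog]
  have h1 := (abs_le.1 hdig).2
  have h2 : stirlingVertRate σ / (t / 2) ^ 2 ≤ 4.36 / t ^ 2 := by
    rw [div_le_div_iff₀ (by positivity) (by positivity)]
    nlinarith [sq_nonneg t]
  have h3 : 1.39 / t ^ 2 ≥ 2 / Real.pi * (4.36 / t ^ 2) / 2 := by
    have hπ2 := Real.pi_gt_d2
    rw [ge_iff_le, show 2 / Real.pi * (4.36 / t ^ 2) / 2 = (4.36 / Real.pi) / t ^ 2 by field_simp]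
    refine div_le_div_of_nonneg_right ?_ (by positivity)
    rw [div_le_iff₀ hπ0]
    nlinarith
  have e2 : 2 / Real.pi * ((Complex.digamma ((σ : ℂ) + ((t / 2 : ℝ) : ℂ) * I)).re / 2 +
      (Real.log q - Real.log Real.pi) / 2) =
      1 / Real.pi * (Real.log q + Real.log (t / 2) - Real.log Real.pi) +
        2 / Real.pi * (((Complex.digamma ((σ : ℂ) + ((t / 2 : ℝ) : ℂ) * I)).re - Real.log (t / 2)) / 2) := by
    ring
  rw [e2]
  have h4 : 2 / Real.pi * (((Complex.digamma ((σ : ℂ) + ((t / 2 : ℝ) : ℂ) * I)).re - Real.log (t / 2)) / 2) ≤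
      2 / Real.pi * (4.36 / t ^ 2) / 2 := by
    have : ((Complex.digamma ((σ : ℂ) + ((t / 2 : ℝ) : ℂ) * I)).re - Real.log (t / 2)) ≤ 4.36 / t ^ 2 :=
      h1.trans h2
    have h0 : 0 ≤ 2 / Real.pi := by positivity
    nlinarith
  linarith

/-- The antiderivative of `log(ct)/t^{j+2}`: `Φ(t) = −(log(ct) + 1/(j+1))/((j+1) t^{j+1})`. -/
theorem hasDerivAt_logAntideriv (j : ℕ) {c t : ℝ} (hc : 0 < c) (ht : 0 < t) :
    HasDerivAt (fun x : ℝ ↦ -(Real.log (c * x) + 1 / ((j : ℝ) + 1)) * (1 / (((j : ℝ) + 1) * x ^ (j + 1))))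
      (Real.log (c * t) / t ^ (j + 2)) t := by
  have hj : ((j : ℝ) + 1) ≠ 0 := by positivity
  have h1 : HasDerivAt (fun x : ℝ ↦ Real.log (c * x) + 1 / ((j : ℝ) + 1)) (c / (c * t)) t := by
    have hl : HasDerivAt (fun x : ℝ ↦ c * x) c t := by
      simpa using (hasDerivAt_id t).const_mul c
    exact (hl.log (mul_ne_zero hc.ne' ht.ne')).add_const _
  have h2 : HasDerivAt (fun x : ℝ ↦ 1 / (((j : ℝ) + 1) * x ^ (j + 1)))
      (1 / ((j : ℝ) + 1) * (-((j + 1 : ℕ) : ℝ) / t ^ (j + 1 + 1))) t := by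
    have h0 := (hasDerivAt_one_div_pow (k := j + 1) (by omega) ht.ne').const_mul (1 / ((j : ℝ) + 1))
    have e : (fun x : ℝ ↦ 1 / (((j : ℝ) + 1) * x ^ (j + 1))) = fun x ↦ 1 / ((j : ℝ) + 1) * (1 / x ^ (j + 1)) := by
      funext x; rw [one_div_mul_one_div]
    rw [e]
    exact h0
  have h := (h1.mul h2).const_mul (-1 : ℝ)
  have e2 : (fun x : ℝ ↦ -(Real.log (c * x) + 1 / ((j : ℝ) + 1)) * (1 / (((j : ℝ) + 1) * x ^ (j + 1)))) =
      fun x ↦ (-1 : ℝ) * ((Real.log (c * x) + 1 / ((j : ℝ) + 1)) * (1 / (((j : ℝ) + 1) * x ^ (j + 1)))) := by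
    funext x; ring
  rw [e2]
  refine h.congr_deriv ?_
  push_cast
  field_simp
  ring

/-- **The smooth part**: for `T ≥ 1000`, `T ≤ U`, `q ≥ 2`,
`∫_T^U (2/π) g_χ(t)/t^{j+2} dt ≤ (1/π)(log(qT/2π) + 1/(j+1))/((j+1) T^{j+1}) + 1.39/((j+3) T^{j+3})`. -/
theorem integral_main_le (χ : DirichletCharacter ℂ q) (hq : 1 < q) (j : ℕ) {T U : ℝ} (hT : 1000 ≤ T) (hTU : T ≤ U) :
    ∫ t in T..U, 1 / t ^ (j + 2) * (2 / Real.pi * charGammaDensity χ t) ≤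
      1 / Real.pi * ((Real.log (q * T / (2 * Real.pi)) + 1 / ((j : ℝ) + 1)) / (((j : ℝ) + 1) * T ^ (j + 1))) +
        1.39 / (((j : ℝ) + 3) * T ^ (j + 3)) := by
  have hπ := Real.pi_pos
  have hπ4 := Real.pi_lt_d2
  have hT0 : 0 < T := by linarith
  have hq2 : (2 : ℝ) ≤ q := by exact_mod_cast hq
  set c : ℝ := q / (2 * Real.pi) with hc
  have hc0 : 0 < c := by positivity
  have hct : ∀ t, q * t / (2 * Real.pi) = c * t := fun t ↦ by rw [hc]; ring
  have hne : ∀ t ∈ uIcc T U, 0 < t := fun t ht ↦ by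
    rw [uIcc_of_le hTU] at ht; exact lt_of_lt_of_le hT0 ht.1
  -- pointwise majorant
  have hmaj : ∀ t ∈ Icc T U, 1 / t ^ (j + 2) * (2 / Real.pi * charGammaDensity χ t) ≤
      1 / Real.pi * (Real.log (c * t) / t ^ (j + 2)) + 1.39 / ((j : ℝ) + 3) * (((j : ℝ) + 3) / t ^ (j + 3 + 1)) := by
    intro t ht
    have ht0 : 0 < t := lt_of_lt_of_le hT0 ht.1
    have h := two_div_pi_mul_charGammaDensity_le χ (show (2 : ℝ) ≤ t by linarith [ht.1])
    rw [hct t] at h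
    have hpos : 0 < 1 / t ^ (j + 2) := by positivity
    calc 1 / t ^ (j + 2) * (2 / Real.pi * charGammaDensity χ t)
        ≤ 1 / t ^ (j + 2) * (1 / Real.pi * Real.log (c * t) + 1.39 / t ^ 2) :=
          mul_le_mul_of_nonneg_left h hpos.le
      _ = _ := by field_simp; ring
  -- integrability
  have hgc := CharCount.continuous_charGammaDensity χ
  have hiL : IntervalIntegrable (fun t : ℝ ↦ 1 / t ^ (j + 2) * (2 / Real.pi * charGammaDensity χ t)) volume T U := by
    refine ContinuousOn.intervalIntegrable (continuousOn_of_forall_continuousAt fun t ht ↦ ?_)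
    have : t ^ (j + 2) ≠ 0 := pow_ne_zero _ (hne t ht).ne'
    exact (by fun_prop (disch := assumption) : ContinuousAt (fun t : ℝ ↦ 1 / t ^ (j + 2)) t).mul
      (continuousAt_const.mul hgc.continuousAt)
  have hi1 : IntervalIntegrable (fun t : ℝ ↦ Real.log (c * t) / t ^ (j + 2)) volume T U := by
    refine ContinuousOn.intervalIntegrable (continuousOn_of_forall_continuousAt fun t ht ↦ ?_)
    have h1 : t ^ (j + 2) ≠ 0 := pow_ne_zero _ (hne t ht).ne'
    have h2 : c * t ≠ 0 := by have := hne t ht; positivity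
    fun_prop (disch := assumption)
  have hi2 : IntervalIntegrable (fun t : ℝ ↦ ((j : ℝ) + 3) / t ^ (j + 3 + 1)) volume T U := by
    refine ContinuousOn.intervalIntegrable (continuousOn_of_forall_continuousAt fun t ht ↦ ?_)
    have : t ^ (j + 3 + 1) ≠ 0 := pow_ne_zero _ (hne t ht).ne'
    fun_prop (disch := assumption)
  have hiR := (hi1.const_mul (1 / Real.pi)).add (hi2.const_mul (1.39 / ((j : ℝ) + 3)))
  refine (intervalIntegral.integral_mono_on hTU hiL hiR hmaj).trans ?_
  rw [intervalIntegral.integral_add (hi1.const_mul _) (hi2.const_mul _), intervalIntegral.integral_const_mul,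
    intervalIntegral.integral_const_mul]
  -- the log integral via its antiderivative
  have hlogint : ∫ t in T..U, Real.log (c * t) / t ^ (j + 2) ≤
      (Real.log (c * T) + 1 / ((j : ℝ) + 1)) / (((j : ℝ) + 1) * T ^ (j + 1)) := by
    have hd : ∀ t ∈ uIcc T U, HasDerivAt
        (fun x : ℝ ↦ -(Real.log (c * x) + 1 / ((j : ℝ) + 1)) * (1 / (((j : ℝ) + 1) * x ^ (j + 1))))
        (Real.log (c * t) / t ^ (j + 2)) t := fun t ht ↦ hasDerivAt_logAntideriv j hc0 (hne t ht)
    rw [integral_eq_sub_of_hasDerivAt hd hi1]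
    have hU0 : 0 < U := by linarith
    have hlogU : 0 ≤ Real.log (c * U) := Real.log_nonneg (by
      rw [hc]; rw [div_mul_eq_mul_div, le_div_iff₀ (by positivity)]; nlinarith)
    have hposU : 0 ≤ (Real.log (c * U) + 1 / ((j : ℝ) + 1)) * (1 / (((j : ℝ) + 1) * U ^ (j + 1))) := by
      positivity
    have e : (Real.log (c * T) + 1 / ((j : ℝ) + 1)) / (((j : ℝ) + 1) * T ^ (j + 1)) =
        (Real.log (c * T) + 1 / ((j : ℝ) + 1)) * (1 / (((j : ℝ) + 1) * T ^ (j + 1))) := by ring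
    rw [e]
    linarith
  have hU0 : 0 < U := by linarith
  have htail : ∫ t in T..U, ((j : ℝ) + 3) / t ^ (j + 3 + 1) ≤ 1 / T ^ (j + 3) := by
    have h := integral_div_pow_succ (k := j + 3) (by omega) hT0 hTU
    push_cast at h
    rw [h]
    have : 0 ≤ 1 / U ^ (j + 3) := by positivity
    linarith
  rw [hct T]
  have hA : 0 ≤ 1 / Real.pi := by positivity
  have hB : 0 ≤ (1.39 : ℝ) / ((j : ℝ) + 3) := by positivity
  have e3 : 1.39 / (((j : ℝ) + 3) * T ^ (j + 3)) = 1.39 / ((j : ℝ) + 3) * (1 / T ^ (j + 3)) := by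
    field_simp
  rw [e3]
  exact add_le_add (mul_le_mul_of_nonneg_left hlogint hA) (mul_le_mul_of_nonneg_left htail hB)

end FarChar

end Summit.RiemannHypothesis.RiemannHypothesis.Theorems.LiTheory

end
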